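import Literature.Geometry.Lorentzian.KillingChartJetRigidity
import Literature.Analysis.ODE.AnalyticParametricLinear
import HarnessLib

/-!
# Killing fields of a real-analytic metric extend analytically over coordinate balls
# (Nomizu 1960, Theorem 1: the analysis in a chart)

K. Nomizu, *On local and global existence of Killing vector fields*, Ann. of Math. (2) 72 (1960)
105–120, Theorem 1: on a real-analytic (pseudo-)Riemannian manifold every point has a
neighbourhood `U` such that a Killing field defined on a connected open subset of `U` extends to a
Killing field on `U` (the local half of Nomizu's analytic-continuation theorem, Thm. 2 ibid.;
pseudo-Riemannian reading: Chruściel 1997, Thm. 2.1 and footnote; continuation scheme as in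
Kobayashi–Nomizu I, Ch. VI, Thm. 6.1). This file proves the statement **in a chart**, for the
coordinate Killing equation `DG(X)(·,·) + G(DX ·,·) + G(·, DX ·) = 0` of a real-analytic field `G`
of symmetric nondegenerate bilinear forms on a ball of a finite-dimensional real normed space
(the equation of `KillingChartJetRigidity.lean`; O'Neill 1983, Ch. 9, Prop. 9.25 in coordinates):

* `exists_transportOp` — the **Killing transport system**: operators `L_y(v)` on `1`-jets
  `E × L(E, E)`, real-analytic in `(y, v)`, with `(DX v, D²X v) = L(v)(X, DX)` for every `C²`
  Killing solution (the braid identity `KillingJetRigidity.two_mul_apply_fderiv_fderiv`, Wald 1984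
  (C.3.6), solved for `D²X` through the inverse pairing `G⁻¹`, which is analytic in `y`);
* `hasDerivAt_jet_lineMap` — along a segment the `1`-jet of a Killing solution solves
  `J' = L J`;
* `eqOn_of_eventuallyEq` — unique continuation: two `C²` Killing solutions on a preconnected open
  set agreeing near a point agree (O'Neill 1983, Ch. 9, Lemma 9.28);
* **`exists_extension_ball`** — a `C²` Killing solution on `B_ρ(c)` extends to a REAL-ANALYTIC
  Killing solution on `B_r(c) ⊇ B_ρ(c)` when `G` is real-analytic on `B_r(c)`: solve the ray
  systems `J' = L_{c+τ(x-c)}(x - c) J` from the jet of `X` at `c`, real-analytically in the endpoint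
  `x` (`Literature.Analysis.ODE.exists_contDiffOn_linearODE_param_withTop`, analytic dependence on
  parameters), observe `X' = X` near `c` by uniqueness of solutions, and kill the Killing
  expression of `X'` — analytic on the connected ball, zero near `c` — by the identity theorem;
* `exists_extension_of_mem_ball` — the same from any point of the half ball `B_{r/2}(c)` (two
  central extensions compared by unique continuation), i.e. every Killing germ at a point of
  `B_{r/2}(c)` is the germ of an analytic Killing solution on `B_r(c)`.

In particular Killing fields of analytic metrics are analytic. The manifold-level repackaging and
the global monodromy argument (Nomizu's Thm. 2) are left to the importing files. Everything is
proved; no definitions, no named facts (D-0026).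

## References

* K. Nomizu, Ann. of Math. (2) 72 (1960) 105–120, Theorems 1–2. [Nomizu1960]
* P. T. Chruściel, *On rigidity of analytic black holes*, Commun. Math. Phys. 189 (1997) 1–7,
  Thm. 2.1 (arXiv:gr-qc/9610011). [Chrusciel1997]
* S. Kobayashi, K. Nomizu, *Foundations of Differential Geometry* I (1963), Ch. VI, §6, Thm. 6.1
  and its Lemmas 1–4.
* B. O'Neill, *Semi-Riemannian geometry* (1983), Ch. 9, Prop. 9.25, Lemma 9.28. [ONeill1983]
* R. M. Wald, *General Relativity* (1984), App. C.3, (C.3.6)–(C.3.9). [Wald1984]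
* S. Lang, *Differential and Riemannian Manifolds* (1995), Ch. IV §1, Thm. 1.14, 1.16. [Lang1995]
-/

noncomputable section

-- instance search through the nested operator types `E →L[ℝ] E →L[ℝ] E →L[ℝ] ℝ` (as in the tree files)
set_option maxSynthPendingDepth 3

open Set Filter Module Function Metric

open scoped ContDiff Topology

namespace Literature.Geometry.Lorentzian

namespace KillingAnalyticChart

universe u

variable {E : Type u} [NormedAddCommGroup E] [NormedSpace ℝ E] [FiniteDimensional ℝ E]
  {G : E → E →L[ℝ] E →L[ℝ] ℝ} {s : Set E}

/-! ### Nondegeneracy: the metric pairing is an invertible operator -/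

/-- A nondegenerate form on a finite-dimensional space, viewed as the operator `u ↦ G(u, ·)`
into the dual, is invertible (injective between spaces of equal dimension). [folklore] -/
theorem isInvertible_of_nondegenerate (B : E →L[ℝ] E →L[ℝ] ℝ)
    (hnd : ∀ u, (∀ w, B u w = 0) → u = 0) : B.IsInvertible := by
  have hinj : Injective B := by
    refine (injective_iff_map_eq_zero _).2 fun u hu ↦ hnd u fun w ↦ ?_
    rw [hu, zero_apply]
  have hbij : Bijective B :=
    ⟨hinj, (LinearMap.injective_iff_surjective_of_finrank_eq_finrank
      (f := (B : E →ₗ[ℝ] E →L[ℝ] ℝ)) JetRigidity.finrank_dual_clm.symm).1 hinj⟩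
  exact JetRigidity.isInvertible_of_bijective hbij

/-- The inverse pairing `y ↦ G_y⁻¹ : E* → E` of a `C^n` field of nondegenerate forms on an open set
is `C^n` there (inversion is analytic on invertible operators). [folklore] -/
theorem contDiffOn_inverse {n : ℕ∞ω} (hG : ContDiffOn ℝ n G s)
    (hnd : ∀ y ∈ s, ∀ u, (∀ w, G y u w = 0) → u = 0) :
    ContDiffOn ℝ n (fun y ↦ (G y).inverse) s := fun y hy ↦
  ((isInvertible_of_nondegenerate (G y) (hnd y hy)).contDiffAt_map_inverse.comp_contDiffWithinAt
    y (hG y hy) :)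

/-! ### The Killing transport operator -/

set_option maxHeartbeats 1600000 in
/-- **The Killing transport system of a field of nondegenerate forms.** For a `C^ω` field `G` of
symmetric nondegenerate bilinear forms on an open set `s` there is a family of operators
`L_y(v)` on the space of `1`-jets `E × L(E, E)`, real-analytic in `(y, v) ∈ s × E`, such that the
`1`-jet `(X, DX)` of every `C²` solution of the coordinate Killing equation
`DG(X)(·,·) + G(DX ·, ·) + G(·, DX ·) = 0` on an open subset of `s` satisfies
`(DX_x v, D²X_x v) = L_x(v)(X x, DX_x)`: its derivative in any direction is a linear function of
itself, with analytic coefficients. `L` solves the braid (Koszul) identity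
`2 G_x(D²X_x(z,u), w) = -(T(z;u,w) + T(u;z,w) - T(w;z,u))`
(`KillingJetRigidity.two_mul_apply_fderiv_fderiv`; Wald 1984, (C.3.6), `∇_a∇_b ξ_c = -R_{bcad} ξ^d`)
for `D²X` through the inverse pairing `G_x⁻¹`. This is the prolongation of the Killing equation
to a connection on `1`-jets used by Nomizu (1960, §§1–2: a Killing field is determined by
`(X, ∇X)` along any curve through a linear differential equation). [cite: Wald1984, App. C.3 (C.3.6)–(C.3.8)] -/
theorem exists_transportOp (hs : IsOpen s) (hG : ContDiffOn ℝ ω G s)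
    (hsymm : ∀ y ∈ s, ∀ u w, G y u w = G y w u)
    (hnd : ∀ y ∈ s, ∀ u, (∀ w, G y u w = 0) → u = 0) :
    ∃ L : E → E → (E × (E →L[ℝ] E)) →L[ℝ] (E × (E →L[ℝ] E)),
      ContDiffOn ℝ ω (fun p : E × E ↦ L p.1 p.2) (s ×ˢ univ) ∧
      ∀ ⦃X : E → E⦄ ⦃t : Set E⦄, IsOpen t → t ⊆ s → ContDiffOn ℝ 2 X t →
        (∀ y ∈ t, ∀ u w,
          fderiv ℝ G y (X y) u w + G y (fderiv ℝ X y u) w + G y u (fderiv ℝ X y w) = 0) →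
        ∀ x ∈ t, ∀ v : E,
          L x v (X x, fderiv ℝ X x) = (fderiv ℝ X x v, fderiv ℝ (fderiv ℝ X) x v) := by
  classical
  -- the braid functional `T_y(z, A)(a; b, w)` and the right-hand side `β`
  let Tf : E → E → (E →L[ℝ] E) → E → E → E → ℝ := fun y z A a b w ↦
    fderiv ℝ (fderiv ℝ G) y a z b w + fderiv ℝ G y (A a) b w + fderiv ℝ G y a (A b) w +
      fderiv ℝ G y a b (A w)
  let βf : E → E → E → (E →L[ℝ] E) → E → E → ℝ := fun y v z A b w ↦
    -(1 / 2 : ℝ) * (Tf y z A v b w + Tf y z A b v w - Tf y z A w v b)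
  -- linearity of `T` in each slot and in the jet
  have T_add_a : ∀ y z A a₁ a₂ b w, Tf y z A (a₁ + a₂) b w = Tf y z A a₁ b w + Tf y z A a₂ b w := by
    intro y z A a₁ a₂ b w
    simp only [Tf, map_add, add_apply]
    ring
  have T_smul_a : ∀ y z A (c : ℝ) a b w, Tf y z A (c • a) b w = c * Tf y z A a b w := by
    intro y z A c a b w
    simp only [Tf, map_smul, smul_apply, smul_eq_mul]
    ring
  have T_add_b : ∀ y z A a b₁ b₂ w, Tf y z A a (b₁ + b₂) w = Tf y z A a b₁ w + Tf y z A a b₂ w := by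
    intro y z A a b₁ b₂ w
    simp only [Tf, map_add, add_apply]
    ring
  have T_smul_b : ∀ y z A (c : ℝ) a b w, Tf y z A a (c • b) w = c * Tf y z A a b w := by
    intro y z A c a b w
    simp only [Tf, map_smul, smul_apply, smul_eq_mul]
    ring
  have T_add_w : ∀ y z A a b w₁ w₂, Tf y z A a b (w₁ + w₂) = Tf y z A a b w₁ + Tf y z A a b w₂ := by
    intro y z A a b w₁ w₂
    simp only [Tf, map_add]
    ring
  have T_smul_w : ∀ y z A (c : ℝ) a b w, Tf y z A a b (c • w) = c * Tf y z A a b w := by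
    intro y z A c a b w
    simp only [Tf, map_smul, smul_eq_mul]
    ring
  have T_add_j : ∀ y z₁ z₂ (A₁ A₂ : E →L[ℝ] E) a b w,
      Tf y (z₁ + z₂) (A₁ + A₂) a b w = Tf y z₁ A₁ a b w + Tf y z₂ A₂ a b w := by
    intro y z₁ z₂ A₁ A₂ a b w
    simp only [Tf, map_add, add_apply]
    ring
  have T_smul_j : ∀ y (c : ℝ) z (A : E →L[ℝ] E) a b w,
      Tf y (c • z) (c • A) a b w = c * Tf y z A a b w := by
    intro y c z A a b w
    simp only [Tf, map_smul, smul_apply, smul_eq_mul]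
    ring
  -- `β` as a covector in `w`
  let βl : E → E → E → (E →L[ℝ] E) → E → E →ₗ[ℝ] ℝ := fun y v z A b ↦
    { toFun := βf y v z A b
      map_add' := fun w₁ w₂ ↦ by
        simp only [βf, T_add_w, T_add_a]
        ring
      map_smul' := fun c w ↦ by
        simp only [βf, T_smul_w, T_smul_a, RingHom.id_apply, smul_eq_mul]
        ring }
  let β : E → E → E → (E →L[ℝ] E) → E → E →L[ℝ] ℝ := fun y v z A b ↦
    LinearMap.toContinuousLinearMap (βl y v z A b)
  have β_apply : ∀ y v z A b w, β y v z A b w = βf y v z A b w := fun _ _ _ _ _ _ ↦ rfl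
  have β_add_b : ∀ y v z A b₁ b₂, β y v z A (b₁ + b₂) = β y v z A b₁ + β y v z A b₂ := by
    intro y v z A b₁ b₂
    ext w
    simp only [add_apply, β_apply, βf, T_add_b, T_add_a, T_add_w]
    ring
  have β_smul_b : ∀ y v z A (c : ℝ) b, β y v z A (c • b) = c • β y v z A b := by
    intro y v z A c b
    ext w
    simp only [smul_apply, β_apply, βf, T_smul_b, T_smul_a, T_smul_w,
      smul_eq_mul]
    ring
  have β_add_j : ∀ y v z₁ z₂ (A₁ A₂ : E →L[ℝ] E) b,
      β y v (z₁ + z₂) (A₁ + A₂) b = β y v z₁ A₁ b + β y v z₂ A₂ b := by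
    intro y v z₁ z₂ A₁ A₂ b
    ext w
    simp only [add_apply, β_apply, βf, T_add_j]
    ring
  have β_smul_j : ∀ y v (c : ℝ) z (A : E →L[ℝ] E) b,
      β y v (c • z) (c • A) b = c • β y v z A b := by
    intro y v c z A b
    ext w
    simp only [smul_apply, β_apply, βf, T_smul_j, smul_eq_mul]
    ring
  -- the second component `M_y(v)(z, A) = G_y⁻¹ β` as an operator in `b`
  let Ml : E → E → E → (E →L[ℝ] E) → E →ₗ[ℝ] E := fun y v z A ↦
    { toFun := fun b ↦ (G y).inverse (β y v z A b)
      map_add' := fun b₁ b₂ ↦ by rw [β_add_b, map_add]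
      map_smul' := fun c b ↦ by rw [β_smul_b, map_smul, RingHom.id_apply] }
  let M : E → E → E → (E →L[ℝ] E) → E →L[ℝ] E := fun y v z A ↦
    LinearMap.toContinuousLinearMap (Ml y v z A)
  have M_apply : ∀ y v z A b, M y v z A b = (G y).inverse (β y v z A b) := fun _ _ _ _ _ ↦ rfl
  -- the transport operator on jets
  let Ll : E → E → (E × (E →L[ℝ] E)) →ₗ[ℝ] (E × (E →L[ℝ] E)) := fun y v ↦
    { toFun := fun j ↦ (j.2 v, M y v j.1 j.2)
      map_add' := fun j₁ j₂ ↦ by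
        ext b
        · simp
        · simp only [Prod.fst_add, Prod.snd_add, add_apply, M_apply,
            β_add_j, map_add]
      map_smul' := fun c j ↦ by
        ext b
        · simp
        · simp only [Prod.smul_fst, Prod.smul_snd, smul_apply, M_apply,
            β_smul_j, map_smul, RingHom.id_apply] }
  let L : E → E → (E × (E →L[ℝ] E)) →L[ℝ] (E × (E →L[ℝ] E)) := fun y v ↦
    LinearMap.toContinuousLinearMap (Ll y v)
  have L_apply : ∀ y v (j : E × (E →L[ℝ] E)), L y v j = (j.2 v, M y v j.1 j.2) := fun _ _ _ ↦ rfl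
  refine ⟨L, ?_, ?_⟩
  · /- analyticity: componentwise on the finite-dimensional jet space -/
    have hD1 : ContDiffOn ℝ ω (fderiv ℝ G) s := hG.fderiv_of_isOpen hs le_rfl
    have hD2 : ContDiffOn ℝ ω (fderiv ℝ (fderiv ℝ G)) s := hD1.fderiv_of_isOpen hs le_rfl
    have hfst : ContDiffOn ℝ ω (fun p : E × E ↦ p.1) (s ×ˢ (univ : Set E)) := contDiffOn_fst
    have hmaps : MapsTo (fun p : E × E ↦ p.1) (s ×ˢ (univ : Set E)) s := fun p hp ↦ hp.1
    have hD1' : ContDiffOn ℝ ω (fun p : E × E ↦ fderiv ℝ G p.1) (s ×ˢ univ) :=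
      hD1.comp hfst hmaps
    have hD2' : ContDiffOn ℝ ω (fun p : E × E ↦ fderiv ℝ (fderiv ℝ G) p.1) (s ×ˢ univ) :=
      hD2.comp hfst hmaps
    have hinv : ContDiffOn ℝ ω (fun p : E × E ↦ (G p.1).inverse) (s ×ˢ univ) :=
      (contDiffOn_inverse hG hnd).comp hfst hmaps
    -- analyticity of `T` along analytic slot maps
    have hT : ∀ (z : E) (A : E →L[ℝ] E) (a b w : E × E → E),
        ContDiffOn ℝ ω a (s ×ˢ univ) → ContDiffOn ℝ ω b (s ×ˢ univ) →
        ContDiffOn ℝ ω w (s ×ˢ univ) →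
        ContDiffOn ℝ ω (fun p : E × E ↦ Tf p.1 z A (a p) (b p) (w p)) (s ×ˢ univ) := by
      intro z A a b w ha hb hw
      have hAa : ContDiffOn ℝ ω (fun p ↦ A (a p)) (s ×ˢ univ) := A.contDiff.comp_contDiffOn ha
      have hAb : ContDiffOn ℝ ω (fun p ↦ A (b p)) (s ×ˢ univ) := A.contDiff.comp_contDiffOn hb
      have hAw : ContDiffOn ℝ ω (fun p ↦ A (w p)) (s ×ˢ univ) := A.contDiff.comp_contDiffOn hw
      exact ((((hD2'.clm_apply ha).clm_apply contDiffOn_const).clm_apply hb).clm_apply hw).add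
        (((hD1'.clm_apply hAa).clm_apply hb).clm_apply hw) |>.add
        (((hD1'.clm_apply ha).clm_apply hAb).clm_apply hw) |>.add
        (((hD1'.clm_apply ha).clm_apply hb).clm_apply hAw)
    rw [contDiffOn_clm_apply]
    rintro ⟨z, A⟩
    have h1 : ContDiffOn ℝ ω (fun p : E × E ↦ A p.2) (s ×ˢ univ) :=
      A.contDiff.comp_contDiffOn contDiffOn_snd
    have h2 : ContDiffOn ℝ ω (fun p : E × E ↦ M p.1 p.2 z A) (s ×ˢ univ) := by
      rw [contDiffOn_clm_apply]
      intro b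
      have hβ : ContDiffOn ℝ ω (fun p : E × E ↦ β p.1 p.2 z A b) (s ×ˢ univ) := by
        rw [contDiffOn_clm_apply]
        intro w
        have e1 := hT z A (fun p ↦ p.2) (fun _ ↦ b) (fun _ ↦ w) contDiffOn_snd contDiffOn_const
          contDiffOn_const
        have e2 := hT z A (fun _ ↦ b) (fun p ↦ p.2) (fun _ ↦ w) contDiffOn_const contDiffOn_snd
          contDiffOn_const
        have e3 := hT z A (fun _ ↦ w) (fun p ↦ p.2) (fun _ ↦ b) contDiffOn_const contDiffOn_snd
          contDiffOn_const
        exact contDiffOn_const.mul ((e1.add e2).sub e3)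
      exact hinv.clm_apply hβ
    simpa only [L_apply] using h1.prodMk h2
  · /- the jet of a Killing solution solves the transport system -/
    intro X t ht hts hX hK x hx v
    have hG2 : ContDiffOn ℝ 2 G t := (hG.mono hts).of_le le_top
    have hsymm' : ∀ y ∈ t, ∀ u w, G y u w = G y w u := fun y hy ↦ hsymm y (hts hy)
    have hGx : (G x).IsInvertible := isInvertible_of_nondegenerate (G x) (hnd x (hts hx))
    rw [L_apply]
    refine Prod.ext rfl ?_
    ext b
    change (G x).inverse (β x v (X x) (fderiv ℝ X x) b) = fderiv ℝ (fderiv ℝ X) x v b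
    have key : β x v (X x) (fderiv ℝ X x) b = G x (fderiv ℝ (fderiv ℝ X) x v b) := by
      ext w
      rw [β_apply]
      have h := KillingJetRigidity.two_mul_apply_fderiv_fderiv ht hG2 hX hsymm' hK hx v b w
      simp only [βf, Tf]
      linarith
    rw [key, hGx.inverse_apply_self]


/-! ### The `1`-jet of a Killing solution along a segment solves the transport system -/

omit [FiniteDimensional ℝ E] in
/-- Along a straight segment `τ ↦ q + τ v` inside the domain of a `C²` Killing solution `X`, the
`1`-jet `τ ↦ (X, DX)(q + τ v)` solves the linear equation `J' = L_{q + τ v}(v) J` for any transport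
operator `L` as in `exists_transportOp` (chain rule). Nomizu 1960, §2 (the ordinary differential
equation satisfied by `(X, A_X)` along a curve); O'Neill 1983, Ch. 9, proof of Lemma 9.28.
[cite: ONeill1983, Ch. 9, Lemma 9.28] -/
theorem hasDerivAt_jet_lineMap {L : E → E → (E × (E →L[ℝ] E)) →L[ℝ] (E × (E →L[ℝ] E))}
    {X : E → E} {t : Set E} (ht : IsOpen t) (hX : ContDiffOn ℝ 2 X t)
    (hL : ∀ x ∈ t, ∀ v : E,
      L x v (X x, fderiv ℝ X x) = (fderiv ℝ X x v, fderiv ℝ (fderiv ℝ X) x v))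
    (q v : E) {τ : ℝ} (hτ : q + τ • v ∈ t) :
    HasDerivAt (fun σ : ℝ ↦ (X (q + σ • v), fderiv ℝ X (q + σ • v)))
      (L (q + τ • v) v (X (q + τ • v), fderiv ℝ X (q + τ • v))) τ := by
  have hγd : HasDerivAt (fun σ : ℝ ↦ q + σ • v) v τ := by
    have h := ((hasDerivAt_id τ).smul_const v).const_add q
    rwa [one_smul] at h
  have hts : t ∈ 𝓝 (q + τ • v) := ht.mem_nhds hτ
  have h1 : HasDerivAt (fun σ : ℝ ↦ X (q + σ • v)) (fderiv ℝ X (q + τ • v) v) τ :=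
    ((hX.differentiableOn two_ne_zero).differentiableAt hts).hasFDerivAt.comp_hasDerivAt τ hγd
  have h2 : HasDerivAt (fun σ : ℝ ↦ fderiv ℝ X (q + σ • v))
      (fderiv ℝ (fderiv ℝ X) (q + τ • v) v) τ :=
    (((hX.fderiv_of_isOpen ht (m := 1) (by norm_num)).differentiableOn
      one_ne_zero).differentiableAt hts).hasFDerivAt.comp_hasDerivAt τ hγd
  rw [hL _ hτ v]
  exact h1.prodMk h2

/-! ### Uniqueness: Killing solutions agreeing near a point agree on a connected domain -/

/-- **Unique continuation of Killing solutions.** Two `C²` solutions of the coordinate Killing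
equation of a `C²` field of symmetric nondegenerate forms on a preconnected open set which agree
near one point agree everywhere (their difference is a solution with vanishing `1`-jet at that
point, `KillingJetRigidity.eqOn_zero_of_isPreconnected`). O'Neill 1983, Ch. 9, Lemma 9.28 and
Prop. 9.26 ff. (a Killing field vanishing on an open set of a connected manifold vanishes);
Kobayashi–Nomizu I, Ch. VI, Lemma 4 for Thm. 6.1. [cite: ONeill1983, Ch. 9, Lemma 9.28] -/
theorem eqOn_of_eventuallyEq (hs : IsOpen s) (hconn : IsPreconnected s)
    (hG : ContDiffOn ℝ 2 G s) (hsymm : ∀ y ∈ s, ∀ u w, G y u w = G y w u)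
    (hnd : ∀ y ∈ s, ∀ u, (∀ w, G y u w = 0) → u = 0)
    {X₁ X₂ : E → E} (hX₁ : ContDiffOn ℝ 2 X₁ s) (hX₂ : ContDiffOn ℝ 2 X₂ s)
    (hK₁ : ∀ y ∈ s, ∀ u w,
      fderiv ℝ G y (X₁ y) u w + G y (fderiv ℝ X₁ y u) w + G y u (fderiv ℝ X₁ y w) = 0)
    (hK₂ : ∀ y ∈ s, ∀ u w,
      fderiv ℝ G y (X₂ y) u w + G y (fderiv ℝ X₂ y u) w + G y u (fderiv ℝ X₂ y w) = 0)
    {x₀ : E} (hx₀ : x₀ ∈ s) (heq : X₁ =ᶠ[𝓝 x₀] X₂) : EqOn X₁ X₂ s := by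
  set X : E → E := fun y ↦ X₁ y - X₂ y with hXdef
  have hX : ContDiffOn ℝ 2 X s := hX₁.sub hX₂
  have hfd : ∀ y ∈ s, fderiv ℝ X y = fderiv ℝ X₁ y - fderiv ℝ X₂ y := fun y hy ↦
    fderiv_sub ((hX₁.differentiableOn two_ne_zero).differentiableAt (hs.mem_nhds hy))
      ((hX₂.differentiableOn two_ne_zero).differentiableAt (hs.mem_nhds hy))
  have hK : ∀ y ∈ s, ∀ u w,
      fderiv ℝ G y (X y) u w + G y (fderiv ℝ X y u) w + G y u (fderiv ℝ X y w) = 0 := by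
    intro y hy u w
    have h1 := hK₁ y hy u w
    have h2 := hK₂ y hy u w
    rw [hfd y hy]
    simp only [hXdef, map_sub, _root_.sub_apply]
    linarith
  have h0 : X x₀ = 0 := sub_eq_zero.2 heq.self_of_nhds
  have h1 : fderiv ℝ X x₀ = 0 := by
    have hev : X =ᶠ[𝓝 x₀] fun _ ↦ (0 : E) := heq.mono fun y hy ↦ sub_eq_zero.2 hy
    rw [hev.fderiv_eq, fderiv_const_apply]
  have h := KillingJetRigidity.eqOn_zero_of_isPreconnected hs hconn hG hX hsymm hnd hK hx₀ h0 h1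
  intro y hy
  exact sub_eq_zero.1 (h y hy).1

/-! ### Analytic extension over a coordinate ball -/

set_option maxHeartbeats 1600000 in
/-- **Killing solutions of an analytic metric extend analytically over coordinate balls
(Nomizu 1960, Theorem 1 in a chart).** Let `G` be a real-analytic field of symmetric
nondegenerate bilinear forms on the ball `B_r(c)` of a finite-dimensional real normed space, and
let `X` be a `C²` solution of the coordinate Killing equation
`DG_y(X y)(u, w) + G_y(DX_y u, w) + G_y(u, DX_y w) = 0` on a smaller concentric ball `B_ρ(c)`.
Then there is a real-analytic solution `X'` of the Killing equation on all of `B_r(c)` with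
`X' = X` on `B_ρ(c)`. Proof (Nomizu's analytic continuation; Kobayashi–Nomizu I, Ch. VI, proof of
Thm. 6.1, with straight chart segments for geodesics): the `1`-jet `(X, DX)` satisfies along every
ray `τ ↦ c + τ (x - c)` the linear system `J' = L_{c + τ(x - c)}(x - c) J` with real-analytic
coefficients (`exists_transportOp`, `hasDerivAt_jet_lineMap`); solving it from the jet of `X` at
`c` defines `X'(x) = J_x(1)` on the whole ball, real-analytically in `x`
(`Literature.Analysis.ODE.exists_contDiffOn_linearODE_param_withTop`, Poincaré–Lang analytic
dependence on parameters); `X' = X` near `c` by uniqueness of solutions, so the Killing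
expression of `X'`, a real-analytic function on the connected ball vanishing near `c`, vanishes
identically (identity theorem); finally `X' = X` on all of `B_ρ(c)` by unique continuation
(`eqOn_of_eventuallyEq`). [cite: Nomizu1960, Theorem 1] -/
theorem exists_extension_ball {c : E} {r : ℝ} (hG : ContDiffOn ℝ ω G (ball c r))
    (hsymm : ∀ y ∈ ball c r, ∀ u w, G y u w = G y w u)
    (hnd : ∀ y ∈ ball c r, ∀ u, (∀ w, G y u w = 0) → u = 0)
    {X : E → E} {ρ : ℝ} (hρ : 0 < ρ) (hρr : ρ ≤ r) (hX : ContDiffOn ℝ 2 X (ball c ρ))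
    (hK : ∀ y ∈ ball c ρ, ∀ u w,
      fderiv ℝ G y (X y) u w + G y (fderiv ℝ X y u) w + G y u (fderiv ℝ X y w) = 0) :
    ∃ X' : E → E, ContDiffOn ℝ ω X' (ball c r) ∧
      (∀ y ∈ ball c r, ∀ u w,
        fderiv ℝ G y (X' y) u w + G y (fderiv ℝ X' y u) w + G y u (fderiv ℝ X' y w) = 0) ∧
      EqOn X' X (ball c ρ) := by
  have hr : 0 < r := lt_of_lt_of_le hρ hρr
  have hρsub : ball c ρ ⊆ ball c r := ball_subset_ball hρr
  -- the transport operator and the jet equation of `X`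
  obtain ⟨L, hLa, hLK⟩ := exists_transportOp isOpen_ball hG hsymm hnd
  have hLX := hLK isOpen_ball hρsub hX hK
  set j₀ : E × (E →L[ℝ] E) := (X c, fderiv ℝ X c) with hj₀
  -- the coefficient of the ray system `J' = A(x, τ) J`
  set A : E → ℝ → (E × (E →L[ℝ] E)) →L[ℝ] (E × (E →L[ℝ] E)) :=
    fun x τ ↦ L (c + τ • (x - c)) (x - c) with hA_def
  -- rays from `c` to points of `B_{r'}(c)` stay in `B_r(c)` for times `|τ| < r / r'`
  have hray : ∀ r' ∈ Ioo 0 r, ∀ x ∈ ball c r', ∀ τ : ℝ, |τ| < r / r' →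
      c + τ • (x - c) ∈ ball c r := by
    intro r' hr' x hx τ hτ
    rw [mem_ball, dist_eq_norm] at hx
    rw [mem_ball, dist_eq_norm, add_sub_cancel_left, norm_smul, Real.norm_eq_abs]
    calc |τ| * ‖x - c‖ ≤ |τ| * r' := by gcongr
      _ < r / r' * r' := mul_lt_mul_of_pos_right hτ hr'.1
      _ = r := div_mul_cancel₀ r hr'.1.ne'
  -- analyticity of the coefficient
  have hAan : ∀ r' ∈ Ioo 0 r, ContDiffOn ℝ ω (fun q : E × ℝ ↦ A q.1 q.2)
      (ball c r' ×ˢ Ioo (-(r / r')) (r / r')) := by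
    intro r' hr'
    have hinner : ContDiff ℝ ω (fun q : E × ℝ ↦ (c + q.2 • (q.1 - c), q.1 - c)) :=
      (contDiff_const.add (contDiff_snd.smul (contDiff_fst.sub contDiff_const))).prodMk
        (contDiff_fst.sub contDiff_const)
    refine hLa.comp hinner.contDiffOn ?_
    rintro ⟨x, τ⟩ ⟨hx, hτ⟩
    exact ⟨hray r' hr' x hx τ (abs_lt.2 hτ), mem_univ _⟩
  -- continuity of `τ ↦ A x τ` on time intervals along which the ray stays in the ball
  have hAcont : ∀ x : E, ∀ m : ℝ, (∀ τ ∈ Ioo (-m) m, c + τ • (x - c) ∈ ball c r) →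
      ContinuousOn (A x) (Ioo (-m) m) := by
    intro x m hm
    have hinner : Continuous (fun τ : ℝ ↦ (c + τ • (x - c), x - c)) := by fun_prop
    refine hLa.continuousOn.comp hinner.continuousOn ?_
    intro τ hτ
    exact ⟨hm τ hτ, mem_univ _⟩
  -- uniqueness for the ray system
  have huniq : ∀ x : E, ∀ m : ℝ, 1 < m → (∀ τ ∈ Ioo (-m) m, c + τ • (x - c) ∈ ball c r) →
      ∀ y₁ y₂ : ℝ → E × (E →L[ℝ] E),
      (∀ τ ∈ Ioo (-m) m, HasDerivAt y₁ (A x τ (y₁ τ)) τ) →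
      (∀ τ ∈ Ioo (-m) m, HasDerivAt y₂ (A x τ (y₂ τ)) τ) → y₁ 0 = y₂ 0 → y₁ 1 = y₂ 1 := by
    intro x m hm hmem y₁ y₂ h₁ h₂ h0
    have h := Literature.Analysis.ODE.eqOn_of_hasDerivAt_linear (B := A x)
      (show (0 : ℝ) ∈ Ioo (-m) m from ⟨by linarith, by linarith⟩) (hAcont x m hmem) h₁ h₂ h0
    exact h ⟨by linarith, hm⟩
  -- the analytic solution families on `B_{r'}(c)`, `0 < r' < r`, for times `|τ| < (1 + r/r')/2`
  have hsol : ∀ r' ∈ Ioo 0 r, ∃ u : E → ℝ → E × (E →L[ℝ] E),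
      (∀ x ∈ ball c r', u x 0 = j₀) ∧
      (∀ x ∈ ball c r', ∀ τ ∈ Ioo (-((1 + r / r') / 2)) ((1 + r / r') / 2),
        HasDerivAt (u x) (A x τ (u x τ)) τ) ∧
      ContDiffOn ℝ ω (fun q : E × ℝ ↦ u q.1 q.2)
        (ball c r' ×ˢ Ioo (-((1 + r / r') / 2)) ((1 + r / r') / 2)) := by
    intro r' hr'
    have hT : 1 < r / r' := (one_lt_div hr'.1).2 hr'.2
    exact Literature.Analysis.ODE.exists_contDiffOn_linearODE_param_withTop (n := ω) le_top
      isOpen_ball (by linarith) (by linarith) (hAan r' hr') j₀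
  choose! u hu0 hud hua using hsol
  -- the radius selector and the extension
  set rad : E → ℝ := fun x ↦ (‖x - c‖ + r) / 2 with hrad_def
  have hrad : ∀ x ∈ ball c r, rad x ∈ Ioo 0 r ∧ x ∈ ball c (rad x) := by
    intro x hx
    rw [mem_ball, dist_eq_norm] at hx
    refine ⟨⟨by simp only [hrad_def]; positivity, by simp only [hrad_def]; linarith⟩, ?_⟩
    rw [mem_ball, dist_eq_norm]
    simp only [hrad_def]
    linarith
  have hT1 : ∀ r' ∈ Ioo 0 r, 1 < (1 + r / r') / 2 := fun r' hr' ↦ by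
    have hT : 1 < r / r' := (one_lt_div hr'.1).2 hr'.2
    linarith
  have hTlt : ∀ r' ∈ Ioo 0 r, (1 + r / r') / 2 < r / r' := fun r' hr' ↦ by
    have hT : 1 < r / r' := (one_lt_div hr'.1).2 hr'.2
    linarith
  -- rays for times below `(1 + r/r')/2` stay in the ball
  have hray' : ∀ r' ∈ Ioo 0 r, ∀ x ∈ ball c r',
      ∀ τ ∈ Ioo (-((1 + r / r') / 2)) ((1 + r / r') / 2), c + τ • (x - c) ∈ ball c r :=
    fun r' hr' x hx τ hτ ↦ hray r' hr' x hx τ (lt_trans (abs_lt.2 hτ) (hTlt r' hr'))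
  set X' : E → E := fun x ↦ (u (rad x) x 1).1 with hX'_def
  -- (i) near every point, `X'` is one analytic family evaluated at time `1`
  have hlocal : ∀ x₁ ∈ ball c r, X' =ᶠ[𝓝 x₁] fun x ↦ (u (rad x₁) x 1).1 := by
    intro x₁ hx₁
    obtain ⟨hr₁, hxr₁⟩ := hrad x₁ hx₁
    filter_upwards [isOpen_ball.mem_nhds hxr₁, isOpen_ball.mem_nhds hx₁] with x hx hxr
    obtain ⟨hr₂, hxr₂⟩ := hrad x hxr
    show (u (rad x) x 1).1 = (u (rad x₁) x 1).1
    set m : ℝ := min ((1 + r / rad x) / 2) ((1 + r / rad x₁) / 2) with hm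
    have hm1 : 1 < m := lt_min (hT1 _ hr₂) (hT1 _ hr₁)
    have hsub₁ : Ioo (-m) m ⊆ Ioo (-((1 + r / rad x) / 2)) ((1 + r / rad x) / 2) :=
      Ioo_subset_Ioo (neg_le_neg (min_le_left _ _)) (min_le_left _ _)
    have hsub₂ : Ioo (-m) m ⊆ Ioo (-((1 + r / rad x₁) / 2)) ((1 + r / rad x₁) / 2) :=
      Ioo_subset_Ioo (neg_le_neg (min_le_right _ _)) (min_le_right _ _)
    have hmem : ∀ τ ∈ Ioo (-m) m, c + τ • (x - c) ∈ ball c r :=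
      fun τ hτ ↦ hray' (rad x) hr₂ x hxr₂ τ (hsub₁ hτ)
    have h := huniq x m hm1 hmem (u (rad x) x) (u (rad x₁) x)
      (fun τ hτ ↦ hud (rad x) hr₂ x hxr₂ τ (hsub₁ hτ))
      (fun τ hτ ↦ hud (rad x₁) hr₁ x hx τ (hsub₂ hτ))
      (by rw [hu0 (rad x) hr₂ x hxr₂, hu0 (rad x₁) hr₁ x hx])
    rw [h]
  -- (ii) `X'` is real-analytic on the ball
  have hX'an : ContDiffOn ℝ ω X' (ball c r) := by
    intro x₁ hx₁
    obtain ⟨hr₁, hxr₁⟩ := hrad x₁ hx₁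
    have hmem : (x₁, (1 : ℝ)) ∈ ball c (rad x₁) ×ˢ
        Ioo (-((1 + r / rad x₁) / 2)) ((1 + r / rad x₁) / 2) :=
      ⟨hxr₁, by constructor <;> linarith [hT1 _ hr₁]⟩
    have hc : ContDiffAt ℝ ω (fun q : E × ℝ ↦ u (rad x₁) q.1 q.2) (x₁, 1) :=
      (hua (rad x₁) hr₁).contDiffAt ((isOpen_ball.prod isOpen_Ioo).mem_nhds hmem)
    have hu1 : ContDiffAt ℝ ω (fun x ↦ (u (rad x₁) x 1).1) x₁ :=
      (hc.comp x₁ (contDiffAt_id.prodMk contDiffAt_const)).fst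
    exact (hu1.congr_of_eventuallyEq (hlocal x₁ hx₁)).contDiffWithinAt
  -- (iii) `X' = X` on `B_{ρ/2}(c)`: the jet of `X` along the ray solves the same system
  have hagree : EqOn X' X (ball c (ρ / 2)) := by
    intro x hx
    have hxρ : ‖x - c‖ < ρ / 2 := by rwa [mem_ball, dist_eq_norm] at hx
    have hxr : x ∈ ball c r := hρsub (ball_subset_ball (by linarith) hx)
    obtain ⟨hr₂, hxr₂⟩ := hrad x hxr
    -- the jet curve of `X`
    set J : ℝ → E × (E →L[ℝ] E) := fun τ ↦ (X (c + τ • (x - c)), fderiv ℝ X (c + τ • (x - c)))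
      with hJ_def
    have hJmem : ∀ τ ∈ Ioo (-2 : ℝ) 2, c + τ • (x - c) ∈ ball c ρ := by
      intro τ hτ
      rw [mem_ball, dist_eq_norm, add_sub_cancel_left, norm_smul, Real.norm_eq_abs]
      have hτ' : |τ| < 2 := abs_lt.2 hτ
      calc |τ| * ‖x - c‖ ≤ 2 * ‖x - c‖ := by gcongr
        _ < 2 * (ρ / 2) := by gcongr
        _ = ρ := by ring
    have hJ : ∀ τ ∈ Ioo (-2 : ℝ) 2, HasDerivAt J (A x τ (J τ)) τ := fun τ hτ ↦
      hasDerivAt_jet_lineMap isOpen_ball hX hLX c (x - c) (hJmem τ hτ)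
    set m : ℝ := min 2 ((1 + r / rad x) / 2) with hm
    have hm1 : 1 < m := lt_min (by norm_num) (hT1 _ hr₂)
    have hsub₁ : Ioo (-m) m ⊆ Ioo (-2 : ℝ) 2 :=
      Ioo_subset_Ioo (neg_le_neg (min_le_left _ _)) (min_le_left _ _)
    have hsub₂ : Ioo (-m) m ⊆ Ioo (-((1 + r / rad x) / 2)) ((1 + r / rad x) / 2) :=
      Ioo_subset_Ioo (neg_le_neg (min_le_right _ _)) (min_le_right _ _)
    have hmem : ∀ τ ∈ Ioo (-m) m, c + τ • (x - c) ∈ ball c r :=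
      fun τ hτ ↦ hρsub (hJmem τ (hsub₁ hτ))
    have h := huniq x m hm1 hmem J (u (rad x) x) (fun τ hτ ↦ hJ τ (hsub₁ hτ))
      (fun τ hτ ↦ hud (rad x) hr₂ x hxr₂ τ (hsub₂ hτ))
      (by rw [hu0 (rad x) hr₂ x hxr₂, hJ_def, hj₀]; simp)
    have hJ1 : (J 1).1 = X x := by simp [hJ_def]
    rw [← hJ1, h]
  -- (iv) the Killing expression of `X'` is analytic on the ball and vanishes near `c`
  have hkill : ∀ y ∈ ball c r, ∀ a b : E,
      fderiv ℝ G y (X' y) a b + G y (fderiv ℝ X' y a) b + G y a (fderiv ℝ X' y b) = 0 := by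
    intro y hy a b
    have hDG : ContDiffOn ℝ ω (fderiv ℝ G) (ball c r) := hG.fderiv_of_isOpen isOpen_ball le_rfl
    have hDX' : ContDiffOn ℝ ω (fderiv ℝ X') (ball c r) :=
      hX'an.fderiv_of_isOpen isOpen_ball le_rfl
    set f : E → ℝ := fun y ↦
      fderiv ℝ G y (X' y) a b + G y (fderiv ℝ X' y a) b + G y a (fderiv ℝ X' y b) with hf_def
    have hf : ContDiffOn ℝ ω f (ball c r) :=
      ((((hDG.clm_apply hX'an).clm_apply contDiffOn_const).clm_apply contDiffOn_const).add
        ((hG.clm_apply (hDX'.clm_apply contDiffOn_const)).clm_apply contDiffOn_const)).add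
        ((hG.clm_apply contDiffOn_const).clm_apply (hDX'.clm_apply contDiffOn_const))
    have hfan : AnalyticOnNhd ℝ f (ball c r) :=
      Literature.Analysis.ODE.analyticOnNhd_of_contDiffOn_omega isOpen_ball hf
    have hzero : f =ᶠ[𝓝 c] 0 := by
      filter_upwards [isOpen_ball.mem_nhds (mem_ball_self (half_pos hρ))] with y hy
      have hev : X' =ᶠ[𝓝 y] X :=
        Filter.eventuallyEq_of_mem (isOpen_ball.mem_nhds hy) hagree
      rw [Pi.zero_apply, hf_def]
      dsimp only
      rw [hev.fderiv_eq, hagree hy]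
      exact hK y (ball_subset_ball (by linarith) hy) a b
    have h := hfan.eqOn_zero_of_preconnected_of_eventuallyEq_zero (convex_ball c r).isPreconnected
      (mem_ball_self hr) hzero hy
    simpa only [hf_def, Pi.zero_apply] using h
  -- (v) `X' = X` on all of `B_ρ(c)` by unique continuation
  refine ⟨X', hX'an, hkill, ?_⟩
  exact eqOn_of_eventuallyEq isOpen_ball (convex_ball c ρ).isPreconnected
    ((hG.mono hρsub).of_le le_top) (fun y hy ↦ hsymm y (hρsub hy)) (fun y hy ↦ hnd y (hρsub hy))
    ((hX'an.mono hρsub).of_le le_top) hX (fun y hy ↦ hkill y (hρsub hy)) hK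
    (mem_ball_self hρ)
    (Filter.eventuallyEq_of_mem (isOpen_ball.mem_nhds (mem_ball_self (half_pos hρ))) hagree)

/-- **Extension of Killing germs from any point of the half ball** (the "every point of `W` has a
normal neighbourhood containing `W`" device of Kobayashi–Nomizu I, Ch. VI, proof of Thm. 6.1, for
chart balls): if `G` is real-analytic, symmetric and nondegenerate on `B_r(c)`, `q ∈ B_{r/2}(c)`,
and `X` is a `C²` Killing solution on `B_ρ(q)` with `ρ ≤ r/2`, then there is a real-analytic
Killing solution `X'` on `B_r(c)` with `X' = X` on `B_ρ(q)`: extend from `q` over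
`B_{r - |q - c|}(q) ∋ c` (`exists_extension_ball` centred at `q`), then from `c` over `B_r(c)`, and
compare the two on the first ball by unique continuation. [cite: Nomizu1960, Theorem 1] -/
theorem exists_extension_of_mem_ball {c : E} {r : ℝ} (hG : ContDiffOn ℝ ω G (ball c r))
    (hsymm : ∀ y ∈ ball c r, ∀ u w, G y u w = G y w u)
    (hnd : ∀ y ∈ ball c r, ∀ u, (∀ w, G y u w = 0) → u = 0)
    {q : E} (hq : q ∈ ball c (r / 2)) {X : E → E} {ρ : ℝ} (hρ : 0 < ρ) (hρr : ρ ≤ r / 2)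
    (hX : ContDiffOn ℝ 2 X (ball q ρ))
    (hK : ∀ y ∈ ball q ρ, ∀ u w,
      fderiv ℝ G y (X y) u w + G y (fderiv ℝ X y u) w + G y u (fderiv ℝ X y w) = 0) :
    ∃ X' : E → E, ContDiffOn ℝ ω X' (ball c r) ∧
      (∀ y ∈ ball c r, ∀ u w,
        fderiv ℝ G y (X' y) u w + G y (fderiv ℝ X' y u) w + G y u (fderiv ℝ X' y w) = 0) ∧
      EqOn X' X (ball q ρ) := by
  have hqc : ‖q - c‖ < r / 2 := by rwa [mem_ball, dist_eq_norm] at hq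
  have hr : 0 < r := by linarith [norm_nonneg (q - c)]
  -- the first ball `B_R(q)`, `R = r - |q - c|`, contains `c` and lies in `B_r(c)`
  set R : ℝ := r - ‖q - c‖ with hR
  have hRr : ball q R ⊆ ball c r := fun y hy ↦ by
    rw [mem_ball, dist_eq_norm] at hy ⊢
    calc ‖y - c‖ ≤ ‖y - q‖ + ‖q - c‖ := norm_sub_le_norm_sub_add_norm_sub y q c
      _ < R + ‖q - c‖ := by gcongr
      _ = r := by rw [hR]; ring
  have hρR : ρ ≤ R := by rw [hR]; linarith
  have hcR : c ∈ ball q R := by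
    rw [mem_ball, dist_comm, dist_eq_norm, hR]
    linarith
  have hsymmR : ∀ y ∈ ball q R, ∀ u w, G y u w = G y w u := fun y hy ↦ hsymm y (hRr hy)
  have hndR : ∀ y ∈ ball q R, ∀ u, (∀ w, G y u w = 0) → u = 0 := fun y hy ↦ hnd y (hRr hy)
  -- step 1: extend over `B_R(q)`
  obtain ⟨X₁, hX₁a, hX₁K, hX₁eq⟩ :=
    exists_extension_ball (hG.mono hRr) hsymmR hndR hρ hρR hX hK
  -- step 2: extend the germ of `X₁` at `c` over `B_r(c)`
  set ρ₁ : ℝ := r - 2 * ‖q - c‖ with hρ₁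
  have hρ₁0 : 0 < ρ₁ := by rw [hρ₁]; linarith
  have hρ₁r : ρ₁ ≤ r := by rw [hρ₁]; linarith [norm_nonneg (q - c)]
  have hsub₁ : ball c ρ₁ ⊆ ball q R := fun y hy ↦ by
    rw [mem_ball, dist_eq_norm] at hy ⊢
    calc ‖y - q‖ ≤ ‖y - c‖ + ‖c - q‖ := norm_sub_le_norm_sub_add_norm_sub y c q
      _ < ρ₁ + ‖q - c‖ := by rw [norm_sub_rev c q]; gcongr
      _ = R := by rw [hρ₁, hR]; ring
  obtain ⟨X', hX'a, hX'K, hX'eq⟩ := exists_extension_ball hG hsymm hnd hρ₁0 hρ₁r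
    ((hX₁a.mono hsub₁).of_le le_top) (fun y hy ↦ hX₁K y (hsub₁ hy))
  -- step 3: `X' = X₁` on `B_R(q)` by unique continuation from `c`
  have heq : EqOn X' X₁ (ball q R) :=
    eqOn_of_eventuallyEq isOpen_ball (convex_ball q R).isPreconnected
      (((hG.mono hRr)).of_le le_top) hsymmR hndR ((hX'a.mono hRr).of_le le_top)
      (hX₁a.of_le le_top) (fun y hy ↦ hX'K y (hRr hy)) hX₁K hcR
      (Filter.eventuallyEq_of_mem (isOpen_ball.mem_nhds (mem_ball_self hρ₁0)) hX'eq)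
  exact ⟨X', hX'a, hX'K, fun y hy ↦ (heq (ball_subset_ball hρR hy)).trans (hX₁eq hy)⟩

end KillingAnalyticChart

end Literature.Geometry.Lorentzian

end
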